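/-
Cell pub-hodgecm2 (COR-CM = Hodge ladder stage 2), seat b12 (prover-pub-hodgecm2-b12-0), 2026-08-20.
JUNCTION (theorems only): the `ModelAxioms` field `weilLine_hodge` for the model of record, by the abstract derivation
`Universe.weilLine_hodge_of_facts` (`Geometry/WeilLineHodge.lean`) over model-2's kernel rows M03 `pull_hodge`, (cone)
`cup2_hodge`, M14 `alphaLine` (`Model/PerLConeFacts.lean`). Tree target `Summits/HodgeConjecture/CorCM/Model/WeilLineHodge.lean`.
-/
import Summits.HodgeConjecture.CorCM.Geometry.WeilLineHodge
import Summits.HodgeConjecture.CorCM.Model.PerLConeFacts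
import HarnessLib

/-!
# COR-CM model layer: `Fact_weilLine_hodge` for the Picard–CM model universe (aside row, P7 input)

`Assembly.hc_cm_of_periodThmF (M : U.ModelAxioms) …` consumes the full 28-field record `ModelAxioms`; its field
`weilLine_hodge` (rfwf Lemma 1.2) is derived for EVERY universe from `pull_hodge`, `cup2_hodge`, `alphaLine`
(`Universe.weilLine_hodge_of_facts`), so for `Model.universeOf hHD hI hU h₃` it is KERNEL over the records
`hHD hI hU h₃` through model-2's `universeOf_fact_pull_hodge`, `universeOf_fact_cup2_hodge`, `universeOf_fact_alphaLine`.
-/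

noncomputable section

namespace Summit.HodgeConjecture.CorCM.Model

open Literature.NumberTheory.Automorphic.PicardCM
open Literature.AlgebraicGeometry.HodgeTheory

/-- **`Fact_weilLine_hodge` for `universeOf`**: the Weil line of the corner product of every face consists of Hodge
classes (rfwf Lemma 1.2), from M03/M14 and the cone fact `cup2_hodge`. [folklore] -/
theorem universeOf_fact_weilLine_hodge (hHD : exists_isReal_hodgeModel) (hI : hodgePQ_independent_of_hodgeModel)
    (hU : BallQuotientUniformisedDatum) (h₃ : CMAbelianVarietyRealised) :
    (universeOf hHD hI hU h₃).Fact_weilLine_hodge :=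
  (universeOf hHD hI hU h₃).weilLine_hodge_of_facts (universeOf_fact_pull_hodge hHD hI hU h₃)
    (universeOf_fact_cup2_hodge hHD hI hU h₃) (universeOf_fact_alphaLine hHD hI hU h₃)

/-- **`Fact_weilLine_hodge` for the model of record `picardCMUniverse hHD hI h₁ h₃`.** [folklore] -/
theorem picardCMUniverse_fact_weilLine_hodge (hHD : exists_isReal_hodgeModel)
    (hI : hodgePQ_independent_of_hodgeModel) (h₁ : BallQuotientUniformised) (h₃ : CMAbelianVarietyRealised) :
    (picardCMUniverse hHD hI h₁ h₃).Fact_weilLine_hodge :=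
  universeOf_fact_weilLine_hodge hHD hI _ h₃

end Summit.HodgeConjecture.CorCM.Model

end
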